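import Summits.Ventures.LatticeQCDFlow.Exactness.FlowSamplerMixtureHarmonicMean
import Summits.Ventures.LatticeQCDFlow.Exactness.Phi4LatticeSymmetry
import HarnessLib

/-!
# Lattice φ⁴: several trained flows proposed as ONE mixture `Σ αᵢq̃ᵢ` — the exact sampler is never worse than the HARMONIC MEAN of the single-flow samplers, for every polynomial observable (`τ + ½ ≤ 1/Σ αᵢ/(τᵢ + ½)`), and one good component suffices (`τ + ½ ≤ (τᵢ + ½)/αᵢ`)

HONEST FRAMING: exact (Metropolis-corrected) sampling algorithms for lattice gauge theory;
figures of merit are autocorrelation/cost numbers at stated couplings and volumes; no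
continuum-physics claim.  (SCALAR calibration rung S0-A: not a gauge result.)

Venture `LatticeQCDFlow` (cell pub-lqcd), topic `Exactness`; FANOUT row 2 (`s0-phi4`, FLOW arm).  NEW
WORK of the cell: the lattice φ⁴ instances of `FlowSamplerMixtureHarmonicMean` (general weight `w`).
Lattice φ⁴ on `n + 1` sites with `S = Σ φJφ + λΣφ⁴`, ANY `λ > 0` and real couplings `J`; finitely many
positive normalised flow densities `q̃ᵢ` (different seeds, architectures, training runs) and weights
`αᵢ > 0`, `Σ αᵢ = 1`; the exact independence sampler `imhOpPhi4 J λ (Σ αᵢq̃ᵢ)` proposing from the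
MIXTURE.  For every `f ∈ PolyObs` with `Var f > 0`:

* **`phi4FlowMixture_tauInt_le_harmonicMean`** — if the normalised autocorrelation series of `f − ⟨f⟩`
  is summable under each single-flow sampler `imhOpPhi4 J λ q̃ᵢ`, then under the mixture sampler it is
  summable and **`τ^{mix}(f) + ½ ≤ 1/Σᵢ αᵢ/(τ^{q̃ᵢ}(f) + ½)`** (≤ the arithmetic mean);
* **`phi4FlowMixture_tauInt_le_single`** — ONE GOOD COMPONENT SUFFICES: summability under `q̃ᵢ` alone
  gives summability under the mixture and `τ^{mix}(f) + ½ ≤ (τ^{q̃ᵢ}(f) + ½)/αᵢ` — mixing anything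
  (a broad "safety" density, an older checkpoint) into a good flow at weight `1 − αᵢ` costs at most the
  factor `1/αᵢ` on `τ + ½`, for every polynomial observable.

Mechanism: the general theorems of `FlowSamplerMixtureHarmonicMean` (pointwise
`min(1, Σαᵢaᵢ/Σαᵢbᵢ)·Σαᵢbᵢ ≥ Σ αᵢ min(aᵢ, bᵢ)` ⇒ `𝓔_{mix} ≥ Σ αᵢ𝓔ᵢ`, then the tree's format-level
variational calculus) specialised to `w = e^{−S}`, `μ` = Lebesgue, `g = f − ⟨f⟩` (`polyObs_sq_integrable`).
Companions: the random ALTERNATION of the flow samplers obeys the same bound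
(`Phi4FlowHMCHybridHarmonicMean`) and is never better than the mixture (`FlowSamplerMixtureVsAlternation`).
Nothing is cited as a fact.

NOT CLAIMED: cost (the mixture proposal evaluates every `q̃ᵢ` at the proposed AND the current field);
that the mixture beats its best component; summability for any network; any value for any run.
-/

namespace Summit.Ventures.LatticeQCDFlow.Exactness

open Real MeasureTheory Filter Finset Topology
open Summit.Ventures.LatticeQCDFlow.Scoring

variable {n : ℕ}

/-- **SEVERAL FLOWS AS ONE MIXTURE PROPOSAL: `τ + ½ ≤` THE WEIGHTED HARMONIC MEAN**, for every
`f ∈ PolyObs` with `Var f > 0` whose series is summable under each single-flow sampler. -/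
theorem phi4FlowMixture_tauInt_le_harmonicMean {lam : ℝ} (hlam : 0 < lam)
    (J : Fin (n + 1) → Fin (n + 1) → ℝ) {ι : Type*} [Fintype ι] [Nonempty ι]
    {q : ι → (Fin (n + 1) → ℝ) → ℝ} (hq0 : ∀ i φ, 0 < q i φ) (hqm : ∀ i, Measurable (q i))
    (hqi : ∀ i, Integrable (q i)) (hq1 : ∀ i, ∫ φ, q i φ = 1) {α : ι → ℝ} (hα : ∀ i, 0 < α i)
    (hα1 : ∑ i, α i = 1) {f : (Fin (n + 1) → ℝ) → ℝ} (hf : PolyObs f)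
    (hP : 0 < ∫ φ, (f φ - gibbsExpect J lam f) ^ 2 * gibbsWeight J lam φ)
    (hs : ∀ i, Summable fun k => (∫ φ, (f φ - gibbsExpect J lam f)
        * ((imhOpPhi4 J lam (q i))^[k + 1] (fun ψ => f ψ - gibbsExpect J lam f)) φ * gibbsWeight J lam φ)
        / ∫ φ, (f φ - gibbsExpect J lam f) ^ 2 * gibbsWeight J lam φ) :
    (Summable fun k => (∫ φ, (f φ - gibbsExpect J lam f)
        * ((imhOpPhi4 J lam (fun ψ => ∑ i, α i * q i ψ))^[k + 1]
            (fun ψ => f ψ - gibbsExpect J lam f)) φ * gibbsWeight J lam φ)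
        / ∫ φ, (f φ - gibbsExpect J lam f) ^ 2 * gibbsWeight J lam φ) ∧
    tauInt (fun k => (∫ φ, (f φ - gibbsExpect J lam f)
        * ((imhOpPhi4 J lam (fun ψ => ∑ i, α i * q i ψ))^[k]
            (fun ψ => f ψ - gibbsExpect J lam f)) φ * gibbsWeight J lam φ)
        / ∫ φ, (f φ - gibbsExpect J lam f) ^ 2 * gibbsWeight J lam φ) + 1 / 2
      ≤ 1 / ∑ i, α i / (tauInt (fun k => (∫ φ, (f φ - gibbsExpect J lam f)
          * ((imhOpPhi4 J lam (q i))^[k] (fun ψ => f ψ - gibbsExpect J lam f)) φ * gibbsWeight J lam φ)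
          / ∫ φ, (f φ - gibbsExpect J lam f) ^ 2 * gibbsWeight J lam φ) + 1 / 2) := by
  obtain ⟨hgm, hg2⟩ := polyObs_sq_integrable hlam J (polyObs_sub_const hf (gibbsExpect J lam f))
  simp only [imhOpPhi4_eq_imhOp] at hs ⊢
  exact finMixture_tauInt_le_harmonicMean (μ := volume) hα hα1 (fun φ => gibbsWeight_pos J lam φ)
    (continuous_gibbsWeight J lam).measurable (integrable_gibbsWeight hlam J) hq0 hqm hqi hq1 hgm hg2
    hP hs

/-- **ONE GOOD COMPONENT SUFFICES: `τ^{mix}(f) + ½ ≤ (τ^{q̃ᵢ}(f) + ½)/αᵢ`** — summability under the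
single flow `q̃ᵢ` alone. -/
theorem phi4FlowMixture_tauInt_le_single {lam : ℝ} (hlam : 0 < lam)
    (J : Fin (n + 1) → Fin (n + 1) → ℝ) {ι : Type*} [Fintype ι] [Nonempty ι]
    {q : ι → (Fin (n + 1) → ℝ) → ℝ} (hq0 : ∀ i φ, 0 < q i φ) (hqm : ∀ i, Measurable (q i))
    (hqi : ∀ i, Integrable (q i)) (hq1 : ∀ i, ∫ φ, q i φ = 1) {α : ι → ℝ} (hα : ∀ i, 0 < α i)
    (hα1 : ∑ i, α i = 1) {f : (Fin (n + 1) → ℝ) → ℝ} (hf : PolyObs f)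
    (hP : 0 < ∫ φ, (f φ - gibbsExpect J lam f) ^ 2 * gibbsWeight J lam φ) (i : ι)
    (hs : Summable fun k => (∫ φ, (f φ - gibbsExpect J lam f)
        * ((imhOpPhi4 J lam (q i))^[k + 1] (fun ψ => f ψ - gibbsExpect J lam f)) φ * gibbsWeight J lam φ)
        / ∫ φ, (f φ - gibbsExpect J lam f) ^ 2 * gibbsWeight J lam φ) :
    (Summable fun k => (∫ φ, (f φ - gibbsExpect J lam f)
        * ((imhOpPhi4 J lam (fun ψ => ∑ j, α j * q j ψ))^[k + 1]
            (fun ψ => f ψ - gibbsExpect J lam f)) φ * gibbsWeight J lam φ)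
        / ∫ φ, (f φ - gibbsExpect J lam f) ^ 2 * gibbsWeight J lam φ) ∧
    tauInt (fun k => (∫ φ, (f φ - gibbsExpect J lam f)
        * ((imhOpPhi4 J lam (fun ψ => ∑ j, α j * q j ψ))^[k]
            (fun ψ => f ψ - gibbsExpect J lam f)) φ * gibbsWeight J lam φ)
        / ∫ φ, (f φ - gibbsExpect J lam f) ^ 2 * gibbsWeight J lam φ) + 1 / 2
      ≤ (tauInt (fun k => (∫ φ, (f φ - gibbsExpect J lam f)
          * ((imhOpPhi4 J lam (q i))^[k] (fun ψ => f ψ - gibbsExpect J lam f)) φ * gibbsWeight J lam φ)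
          / ∫ φ, (f φ - gibbsExpect J lam f) ^ 2 * gibbsWeight J lam φ) + 1 / 2) / α i := by
  obtain ⟨hgm, hg2⟩ := polyObs_sq_integrable hlam J (polyObs_sub_const hf (gibbsExpect J lam f))
  simp only [imhOpPhi4_eq_imhOp] at hs ⊢
  exact finMixture_tauInt_le_single (μ := volume) hα hα1 (fun φ => gibbsWeight_pos J lam φ)
    (continuous_gibbsWeight J lam).measurable (integrable_gibbsWeight hlam J) hq0 hqm hqi hq1 hgm hg2
    hP i hs

end Summit.Ventures.LatticeQCDFlow.Exactness
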